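import Literature.Analysis.FluidPDE.TorusVorticityTensorTransport
import HarnessLib

/-!
# The transport identity for `|ω|²` and the static weighted identities on `T^d`

Analysis/FluidPDE proof file (theorems only). Continuation of `TorusVorticityTensorTransport`.

1. From `∂ₜWᵢⱼ + (u·∇)Wᵢⱼ = νΔWᵢⱼ − ((∇u∇u)ᵢⱼ − (∇u∇u)ⱼᵢ) + (∂ᵢfⱼ − ∂ⱼfᵢ)` (Majda–Bertozzi 2002,
   (1.31)) and `|ω|² = ½∑ᵢⱼWᵢⱼ²` (`torusVorticitySqAt`), pointwise on `[a, b] × T^d`,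
   `∂ₜ|ω|² = 2σ + ν ∑ᵢⱼ Wᵢⱼ ΔWᵢⱼ + ∑ᵢⱼ Wᵢⱼ(∂ᵢfⱼ − ∂ⱼfᵢ) − ∑ₖ uₖ ∑ᵢⱼ Wᵢⱼ∂ₖWᵢⱼ`
   (`σ = torusStretchingDensity`, `= ω·𝒟ω` on `T³` for `div u = 0`): the vorticity equation
   `Dω/Dt = 𝒟ω + νΔω` (Majda–Bertozzi 2002, (1.32)) paired with `ω`.
2. The two static identities that turn it into weighted balances `d/dt ∫ Φ(|ω|²)` (Gibbon 2010,
   App. A, proof of Prop. 1, with `Φ(s) = sᵐ`): the transport term integrates to zero,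
   `∫ Φ'(|ω|²) (u·∇)|ω|² = ∫ (u·∇)Φ(|ω|²) = 0` (`div u = 0`), and the viscous term by parts,
   `∫ Φ'(|ω|²) ∑ᵢⱼ WᵢⱼΔWᵢⱼ = −∫ Φ'(|ω|²) ∑ₖ∑ᵢⱼ(∂ₖWᵢⱼ)² − ∫ Φ''(|ω|²) ∑ₖ(∂ₖ|ω|²)²`
   (App. A step 1, "the Laplacian term": `∫|ω|^{2(m−1)}ω·Δω ≤ −(2(m−1)/m²)∫|∇(|ω|ᵐ)|²`).

* `IsClassicalNSSolutionOn.timeDerivWithin_torusVorticitySqAt` — item 1;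
* `integral_deriv_comp_mul_convect_torusVorticitySqAt_eq_zero` — the transport term vanishes;
* `integral_deriv_comp_mul_sum_mul_laplacian_torusVorticityTensor` — the viscous term by parts.

## References

* A. J. Majda, A. L. Bertozzi, *Vorticity and Incompressible Flow*, CUP 2002, §1.4 (1.18)–(1.21)
  (`𝒟`, `Ω`, `ω`, `Ωh = ½ω × h`), proof of Prop. 1.5: (1.29) `DV/Dt + V² = −P + νΔV`, (1.31)
  `DΩ/Dt + Ω𝒟 + 𝒟Ω = νΔΩ`, (1.32) `Dω/Dt = 𝒟ω + νΔω` (held: book:majda2002-vorticity-incompressible-flow,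
  chunks 15, 18–19). [MajdaBertozziCUP2002]
* J. D. Gibbon, *Regularity and singularity in solutions of the three-dimensional Navier–Stokes
  equations*, Proc. R. Soc. A 466 (2010) 2587–2604, doi:10.1098/rspa.2009.0642; §2 (definition
  `Jₘ = ∫|ω|^{2m} dV` on the periodic box `[0, L]³`) and Appendix A (proof of Prop. 1): the first
  display is `(1/2m) J̇ₘ = ∫ |ω|^{2(m−1)} ω·{νΔω + ω·∇u + curl f} dV`, step 1 bounds the Laplacian
  term by `−(2(m−1)/m²)∫|∇(|ω|ᵐ)|²` (held: paper:arxiv-0905.0344, chunks 5–6, 9). [Gibbon2010]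
* C. R. Doering, J. D. Gibbon, *Applied Analysis of the Navier–Stokes Equations*, CUP 1995, §6.5
  (6.5.18). [DoeringGibbon1995]
-/

noncomputable section

open Set MeasureTheory Finset
open scoped ContDiff InnerProductSpace RealInnerProductSpace

namespace Literature.Analysis.FluidPDE

open Literature.Analysis.FunctionSpaces

variable {d : Type*} [Fintype d] [DecidableEq d]

/-- `|ω(x)|² = ½ ∑ᵢⱼ Wᵢⱼ(x)²` (definitional). [folklore] -/
private theorem torusVorticitySqAt_eq_half_sum_sq' (v : UnitAddTorus d → EuclideanSpace ℝ d)
    (x : UnitAddTorus d) :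
    torusVorticitySqAt v x = 2⁻¹ * ∑ i, ∑ j, torusVorticityTensor v i j x ^ 2 := rfl

/-- `Wᵢⱼ` of a smooth field is smooth. [folklore] -/
private theorem isSmooth_torusVorticityTensor' {v : UnitAddTorus d → EuclideanSpace ℝ d}
    (hv : Torus.IsSmooth v) (i j : d) : Torus.IsSmooth (torusVorticityTensor v i j) :=
  ((hv.partialDeriv i).apply j).sub ((hv.partialDeriv j).apply i)

/-- `∂ₖ|ω|² = ∑ᵢⱼ Wᵢⱼ ∂ₖWᵢⱼ` for smooth `v`. [folklore] -/
private theorem partialDeriv_torusVorticitySqAt {v : UnitAddTorus d → EuclideanSpace ℝ d}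
    (hv : Torus.IsSmooth v) (k : d) (x : UnitAddTorus d) :
    Torus.partialDeriv k (torusVorticitySqAt v) x =
      ∑ i, ∑ j, torusVorticityTensor v i j x * Torus.partialDeriv k (torusVorticityTensor v i j) x := by
  have hW1 : ∀ i j, Torus.IsContDiff 1 (torusVorticityTensor v i j) :=
    fun i j => (isSmooth_torusVorticityTensor' hv i j).isContDiff (by simp)
  have hsq : ∀ i j, Torus.IsContDiff 1 (fun y => torusVorticityTensor v i j y * torusVorticityTensor v i j y) :=
    fun i j => (hW1 i j).mul (hW1 i j)
  have hrow : ∀ i, Torus.IsContDiff 1 (fun y => ∑ j, torusVorticityTensor v i j y * torusVorticityTensor v i j y) := by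
    intro i
    have h : Torus.lift (fun y => ∑ j, torusVorticityTensor v i j y * torusVorticityTensor v i j y) =
        fun z => ∑ j, Torus.lift (fun y => torusVorticityTensor v i j y * torusVorticityTensor v i j y) z := rfl
    unfold Torus.IsContDiff
    rw [h]
    exact ContDiff.sum fun j _ => hsq i j
  have hfun : torusVorticitySqAt v = fun y => (2⁻¹ : ℝ) •
      ∑ i, ∑ j, torusVorticityTensor v i j y * torusVorticityTensor v i j y := by
    funext y
    rw [torusVorticitySqAt_eq_half_sum_sq', smul_eq_mul]
    congr 1
    exact Finset.sum_congr rfl fun i _ => Finset.sum_congr rfl fun j _ => by ring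
  rw [hfun, Torus.partialDeriv_smul (Torus.isContDiff_const _) ?_ k x]
  swap
  · have h : Torus.lift (fun y => ∑ i, ∑ j, torusVorticityTensor v i j y * torusVorticityTensor v i j y) =
        fun z => ∑ i, Torus.lift (fun y => ∑ j, torusVorticityTensor v i j y * torusVorticityTensor v i j y) z := rfl
    unfold Torus.IsContDiff
    rw [h]
    exact ContDiff.sum fun i _ => hrow i
  have hc : Torus.partialDeriv k (fun _ : UnitAddTorus d => (2⁻¹ : ℝ)) x = 0 := by
    simp [Torus.partialDeriv, Torus.lineDeriv]
  rw [hc, zero_smul, add_zero, Torus.partialDeriv_finset_sum _ (fun i _ => hrow i), smul_eq_mul,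
    Finset.mul_sum]
  refine Finset.sum_congr rfl fun i _ => ?_
  rw [Torus.partialDeriv_finset_sum _ (fun j _ => hsq i j), Finset.mul_sum]
  refine Finset.sum_congr rfl fun j _ => ?_
  rw [Torus.partialDeriv_mul (hW1 i j) (hW1 i j)]
  ring

/-- `|ω|²` of a smooth field is smooth. [folklore] -/
private theorem isSmooth_torusVorticitySqAt {v : UnitAddTorus d → EuclideanSpace ℝ d}
    (hv : Torus.IsSmooth v) : Torus.IsSmooth (torusVorticitySqAt v) := by
  have h : ∀ i j, Torus.IsSmooth (fun y => torusVorticityTensor v i j y ^ 2) := fun i j => by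
    have := isSmooth_torusVorticityTensor' hv i j
    exact this.pow 2
  have hl : Torus.lift (torusVorticitySqAt v) =
      fun z => (2⁻¹ : ℝ) * ∑ i, ∑ j, Torus.lift (fun y => torusVorticityTensor v i j y ^ 2) z := by
    funext z; rfl
  unfold Torus.IsSmooth at h ⊢
  rw [hl]
  exact contDiff_const.mul (ContDiff.sum fun i _ => ContDiff.sum fun j _ => h i j)

/-- Along a jointly smooth `u` on `[a, b] × T^d`, `(s, y) ↦ Wᵢⱼ(u(s))(y)` is jointly smooth. [folklore] -/
private theorem isSmoothSpaceTimeOn_torusVorticityTensor {a b : ℝ}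
    {u : ℝ → UnitAddTorus d → EuclideanSpace ℝ d} (hu : Torus.IsSmoothSpaceTimeOn (Icc a b) u)
    (hab : a < b) (i j : d) :
    Torus.IsSmoothSpaceTimeOn (Icc a b) (fun s y => torusVorticityTensor (u s) i j y) :=
  ((hu.partialDeriv (uniqueDiffOn_Icc hab) i).apply j).sub
    ((hu.partialDeriv (uniqueDiffOn_Icc hab) j).apply i)

/-- **The transport identity for `|ω|²`** — the vorticity equation `Dω/Dt = 𝒟ω + νΔω`
(Majda–Bertozzi 2002, §1.4 (1.32), with forcing `curl f`) paired with `ω`, written over the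
orientation-free `|ω|² = torusVorticitySqAt`, `σ = torusStretchingDensity` in every dimension. Along
a classical solution of `∂ₜu + (u·∇)u = νΔu − ∇p + f`, `div u = 0` on `T^d × [a, b]` (`a < b`),
for every `t ∈ [a, b]` and every point `x`:
`∂ₜ|ω|² = 2σ + ν ∑ᵢⱼ Wᵢⱼ ΔWᵢⱼ + ∑ᵢⱼ Wᵢⱼ (∂ᵢfⱼ − ∂ⱼfᵢ) − ∑ₖ uₖ ∑ᵢⱼ Wᵢⱼ ∂ₖWᵢⱼ`
(one-sided time derivative within `[a, b]`; the last sum is `(u·∇)|ω|²`). In `d = 3`: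
`½ D|ω|²/Dt = ω·𝒟ω + ν ω·Δω + ω·curl f` (Doering–Gibbon 1995, §6.5; Gibbon 2010, App. A at `m = 1`).
[cite: MajdaBertozziCUP2002, §1.4 eq. (1.32)] -/
theorem _root_.Literature.Analysis.FunctionSpaces.Torus.IsClassicalNSSolutionOn.timeDerivWithin_torusVorticitySqAt
    {a b ν : ℝ} {f u : ℝ → UnitAddTorus d → EuclideanSpace ℝ d} {p : ℝ → UnitAddTorus d → ℝ}
    (h : Torus.IsClassicalNSSolutionOn (Icc a b) ν f u p) (hab : a < b) {t : ℝ}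
    (ht : t ∈ Icc a b) (x : UnitAddTorus d) :
    Torus.timeDerivWithin (Icc a b) (fun s y => torusVorticitySqAt (u s) y) t x =
      2 * torusStretchingDensity (u t) x +
        ν * (∑ i, ∑ j, torusVorticityTensor (u t) i j x *
          Torus.laplacian (torusVorticityTensor (u t) i j) x) +
        (∑ i, ∑ j, torusVorticityTensor (u t) i j x *
          (Torus.partialDeriv i (f t) x j - Torus.partialDeriv j (f t) x i)) -
        ∑ k, u t x k * ∑ i, ∑ j, torusVorticityTensor (u t) i j x *
          Torus.partialDeriv k (torusVorticityTensor (u t) i j) x := by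
  set S : Set ℝ := Icc a b with hSdef
  have hU : UniqueDiffOn ℝ S := uniqueDiffOn_Icc hab
  have hu : Torus.IsSmoothSpaceTimeOn S u := h.smooth_velocity
  -- abbreviations for the pointwise data at time `t`
  set W : d → d → ℝ := fun i j => torusVorticityTensor (u t) i j x with hWdef
  set T : d → d → ℝ := fun i j =>
    Torus.timeDerivWithin S (fun s y => torusVorticityTensor (u s) i j y) t x with hTdef
  -- Step 1: `∂ₜ|ω|² = ∑ᵢⱼ Wᵢⱼ ∂ₜWᵢⱼ`
  have hWij : ∀ i j, HasDerivWithinAt (fun s => torusVorticityTensor (u s) i j x) (T i j) S t :=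
    fun i j => (isSmoothSpaceTimeOn_torusVorticityTensor hu hab i j).hasDerivWithinAt_slice ht x
  have hsq : ∀ i j, HasDerivWithinAt (fun s => torusVorticityTensor (u s) i j x ^ 2)
      (2 * W i j * T i j) S t := by
    intro i j
    have h2 := (hWij i j).mul (hWij i j)
    refine (h2.congr_of_mem (fun s _ => by simp only [Pi.mul_apply]; ring) ht).congr_deriv ?_
    simp only [hWdef]
    ring
  have hQ : HasDerivWithinAt (fun s => torusVorticitySqAt (u s) x)
      (2⁻¹ * ∑ i, ∑ j, 2 * W i j * T i j) S t := by
    have hsum := HasDerivWithinAt.fun_sum (u := Finset.univ)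
      (A := fun i s => ∑ j, torusVorticityTensor (u s) i j x ^ 2)
      (A' := fun i => ∑ j, 2 * W i j * T i j) (x := t) (s := S)
      fun i _ => HasDerivWithinAt.fun_sum (u := Finset.univ)
        (A := fun j s => torusVorticityTensor (u s) i j x ^ 2)
        (A' := fun j => 2 * W i j * T i j) (x := t) (s := S) fun j _ => hsq i j
    exact (hsum.const_mul (2⁻¹ : ℝ)).congr_of_mem (fun s _ => rfl) ht
  rw [Torus.timeDerivWithin, hQ.derivWithin (hU t ht)]
  -- Step 2: insert the vorticity-tensor transport identity and simplify
  have hT : ∀ i j, T i j = ν * Torus.laplacian (torusVorticityTensor (u t) i j) x +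
      (Torus.partialDeriv i (f t) x j - Torus.partialDeriv j (f t) x i) -
      ((∑ k, Torus.partialDeriv i (u t) x k * Torus.partialDeriv k (u t) x j) -
        ∑ k, Torus.partialDeriv j (u t) x k * Torus.partialDeriv k (u t) x i) -
      ∑ k, u t x k * Torus.partialDeriv k (torusVorticityTensor (u t) i j) x :=
    fun i j => h.timeDerivWithin_torusVorticityTensor hab ht i j x
  -- the two stretching sums coincide after the relabelling `i ↔ j`
  have hstretch : ∑ i, ∑ j, W i j * ∑ k, Torus.partialDeriv j (u t) x k * Torus.partialDeriv k (u t) x i =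
      torusStretchingDensity (u t) x := by
    rw [torusStretchingDensity, Finset.sum_comm]
    rw [← Finset.sum_neg_distrib]
    refine Finset.sum_congr rfl fun i _ => ?_
    rw [← Finset.sum_neg_distrib]
    refine Finset.sum_congr rfl fun j _ => ?_
    rw [hWdef]
    simp only
    rw [torusVorticityTensor_swap (u t) i j x]
    ring
  have hstretch' : ∑ i, ∑ j, W i j * ∑ k, Torus.partialDeriv i (u t) x k * Torus.partialDeriv k (u t) x j =
      -torusStretchingDensity (u t) x := by
    rw [torusStretchingDensity, neg_neg]
  -- the transport sums: `∑ᵢⱼ Wᵢⱼ ∑ₖ uₖ ∂ₖWᵢⱼ = ∑ₖ uₖ ∑ᵢⱼ Wᵢⱼ ∂ₖWᵢⱼ`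
  have htransp : ∑ i, ∑ j, W i j * ∑ k, u t x k * Torus.partialDeriv k (torusVorticityTensor (u t) i j) x =
      ∑ k, u t x k * ∑ i, ∑ j, W i j * Torus.partialDeriv k (torusVorticityTensor (u t) i j) x := by
    simp_rw [Finset.mul_sum]
    symm
    rw [Finset.sum_comm]
    refine Finset.sum_congr rfl fun i _ => ?_
    rw [Finset.sum_comm]
    refine Finset.sum_congr rfl fun j _ => Finset.sum_congr rfl fun k _ => by ring
  -- assemble
  have hexpand : 2⁻¹ * ∑ i, ∑ j, 2 * W i j * T i j = ∑ i, ∑ j, W i j * T i j := by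
    rw [Finset.mul_sum]
    refine Finset.sum_congr rfl fun i _ => ?_
    rw [Finset.mul_sum]
    refine Finset.sum_congr rfl fun j _ => by ring
  have e1 : ∑ i, ∑ j, W i j * T i j = ∑ i, ∑ j,
      (ν * (W i j * Torus.laplacian (torusVorticityTensor (u t) i j) x) +
        W i j * (Torus.partialDeriv i (f t) x j - Torus.partialDeriv j (f t) x i) -
        W i j * (∑ k, Torus.partialDeriv i (u t) x k * Torus.partialDeriv k (u t) x j) +
        W i j * (∑ k, Torus.partialDeriv j (u t) x k * Torus.partialDeriv k (u t) x i) -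
        W i j * ∑ k, u t x k * Torus.partialDeriv k (torusVorticityTensor (u t) i j) x) := by
    refine Finset.sum_congr rfl fun i _ => Finset.sum_congr rfl fun j _ => ?_
    rw [hT i j]
    ring
  rw [hexpand, e1]
  simp only [Finset.sum_add_distrib, Finset.sum_sub_distrib, ← Finset.mul_sum]
  rw [hstretch, hstretch', htransp]
  ring


/-! ### Static identities for weighted densities `Φ'(|ω|²)·(…)` -/

namespace VorticityTensor

/-- Chain rule for partial derivatives through a scalar function: `∂ₖ(g ∘ θ) = g'(θ) ∂ₖθ` at points
where `g` is differentiable (`θ` of class `C¹`). [folklore] -/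
private theorem partialDeriv_comp_deriv {g : ℝ → ℝ} {θ : UnitAddTorus d → ℝ} (hθ : Torus.IsContDiff 1 θ)
    (x : UnitAddTorus d) (hg : DifferentiableAt ℝ g (θ x)) (k : d) :
    Torus.partialDeriv k (fun y => g (θ y)) x = deriv g (θ x) * Torus.partialDeriv k θ x := by
  unfold Torus.partialDeriv Torus.lineDeriv
  set v : EuclideanSpace ℝ d := EuclideanSpace.single k 1
  have hθ' : HasDerivAt (fun s : ℝ => θ (x + Torus.proj (s • v))) (Torus.lineDeriv θ x v) 0 := by
    simpa using Torus.hasDerivAt_comp_add_proj_smul hθ x v 0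
  have hx0 : θ (x + Torus.proj ((0 : ℝ) • v)) = θ x := by simp
  have hg' : HasDerivAt g (deriv g (θ (x + Torus.proj ((0 : ℝ) • v))))
      (θ (x + Torus.proj ((0 : ℝ) • v))) := by
    rw [hx0]; exact hg.hasDerivAt
  have hc := hg'.comp 0 hθ'
  have hfun : (fun t : ℝ => (fun y => g (θ y)) (x + Torus.proj (t • v))) =
      g ∘ fun s : ℝ => θ (x + Torus.proj (s • v)) := rfl
  rw [hfun, hc.deriv, hx0, hθ'.deriv]

omit [DecidableEq d] in
/-- Smoothness of `g ∘ θ` for `g` smooth on a set containing the values of the smooth `θ`. [folklore] -/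
private theorem isSmooth_comp {g : ℝ → ℝ} {U : Set ℝ} (hg : ContDiffOn ℝ ∞ g U)
    {θ : UnitAddTorus d → ℝ} (hθ : Torus.IsSmooth θ) (hmaps : ∀ x, θ x ∈ U) :
    Torus.IsSmooth (fun y => g (θ y)) :=
  hg.comp_contDiff hθ fun _ => hmaps _

end VorticityTensor

/-- **Transport term** (Gibbon 2010, App. A, proof of Prop. 1: the opening identity for
`(1/2m) J̇ₘ` carries no transport term because `∇·u = 0` on the periodic box). For smooth
divergence-free `v` and `g` smooth on an open set containing the values of `|ω|²`:
`∫ g'(|ω|²) ∑ₖ vₖ ∑ᵢⱼ Wᵢⱼ ∂ₖWᵢⱼ = ∫ (v·∇)(g ∘ |ω|²) = 0`. [cite: Gibbon2010, Appendix A (proof of Prop. 1), opening identity] -/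
theorem integral_deriv_comp_mul_convect_torusVorticitySqAt_eq_zero
    {v : UnitAddTorus d → EuclideanSpace ℝ d} (hv : Torus.IsSmooth v) (hdiv : Torus.IsDivFree v)
    {g : ℝ → ℝ} {U : Set ℝ} (hU : IsOpen U) (hg : ContDiffOn ℝ ∞ g U)
    (hmaps : ∀ x, torusVorticitySqAt v x ∈ U) :
    ∫ x, deriv g (torusVorticitySqAt v x) * ∑ k, v x k * ∑ i, ∑ j,
      torusVorticityTensor v i j x * Torus.partialDeriv k (torusVorticityTensor v i j) x = 0 := by
  have hQ : Torus.IsSmooth (torusVorticitySqAt v) := isSmooth_torusVorticitySqAt hv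
  have hθ : Torus.IsSmooth (fun y => g (torusVorticitySqAt v y)) :=
    VorticityTensor.isSmooth_comp hg hQ hmaps
  have hpt : ∀ x, deriv g (torusVorticitySqAt v x) * ∑ k, v x k * ∑ i, ∑ j,
      torusVorticityTensor v i j x * Torus.partialDeriv k (torusVorticityTensor v i j) x =
      Torus.fderiv (fun y => g (torusVorticitySqAt v y)) x (v x) := by
    intro x
    rw [Torus.fderiv_apply_eq_sum_partialDeriv (hθ.isContDiff (by simp)), Finset.mul_sum]
    refine Finset.sum_congr rfl fun k _ => ?_
    have hgd : DifferentiableAt ℝ g (torusVorticitySqAt v x) :=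
      (hg.differentiableOn (by simp)).differentiableAt (hU.mem_nhds (hmaps x))
    rw [smul_eq_mul, VorticityTensor.partialDeriv_comp_deriv (hQ.isContDiff (by simp)) x hgd k,
      partialDeriv_torusVorticitySqAt hv k x]
    ring
  simp_rw [hpt]
  exact Torus.integral_fderiv_apply_eq_zero_of_isDivFree hv hθ hdiv

/-- **Viscous term by parts** (Gibbon 2010, App. A, step 1 "The Laplacian term": with `φ = |ω|²`,
`∫ φ^{m−1} ω·Δω = ∫ φ^{m−1}(½Δφ − |∇ω|²)`, `∫ φ^{m−1}Δφ = −(m−1)∫φ^{m−2}|∇φ|²`, whence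
`∫|ω|^{2(m−1)}ω·Δω ≤ −(2(m−1)/m²)∫|∇(|ω|ᵐ)|²`; here for a general weight and as an identity, no
boundary terms on the torus). For smooth `v` and `g` smooth on an open set containing the values of
`|ω|²`:
`∫ g'(|ω|²) ∑ᵢⱼ Wᵢⱼ ΔWᵢⱼ = −∫ g'(|ω|²) ∑ₖ∑ᵢⱼ (∂ₖWᵢⱼ)² − ∫ g''(|ω|²) ∑ₖ (∂ₖ|ω|²)²`
(`∂ₖ(g'(|ω|²)Wᵢⱼ) = g'∂ₖWᵢⱼ + g''∂ₖ|ω|² Wᵢⱼ`, `∑ᵢⱼ Wᵢⱼ∂ₖWᵢⱼ = ∂ₖ|ω|²`). [cite: Gibbon2010, Appendix A (proof of Prop. 1), step 1] -/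
theorem integral_deriv_comp_mul_sum_mul_laplacian_torusVorticityTensor
    {v : UnitAddTorus d → EuclideanSpace ℝ d} (hv : Torus.IsSmooth v)
    {g : ℝ → ℝ} {U : Set ℝ} (hU : IsOpen U) (hg : ContDiffOn ℝ ∞ g U)
    (hmaps : ∀ x, torusVorticitySqAt v x ∈ U) :
    ∫ x, deriv g (torusVorticitySqAt v x) * ∑ i, ∑ j,
        torusVorticityTensor v i j x * Torus.laplacian (torusVorticityTensor v i j) x =
      -(∫ x, deriv g (torusVorticitySqAt v x) * ∑ k, ∑ i, ∑ j,
          Torus.partialDeriv k (torusVorticityTensor v i j) x ^ 2) -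
        ∫ x, deriv (deriv g) (torusVorticitySqAt v x) *
          ∑ k, Torus.partialDeriv k (torusVorticitySqAt v) x ^ 2 := by
  -- smoothness bookkeeping
  have hQ : Torus.IsSmooth (torusVorticitySqAt v) := isSmooth_torusVorticitySqAt hv
  have hg1 : ContDiffOn ℝ ∞ (deriv g) U := hg.deriv_of_isOpen hU le_rfl
  have hG1 : Torus.IsSmooth (fun y => deriv g (torusVorticitySqAt v y)) :=
    VorticityTensor.isSmooth_comp hg1 hQ hmaps
  have hG2 : Torus.IsSmooth (fun y => deriv (deriv g) (torusVorticitySqAt v y)) :=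
    VorticityTensor.isSmooth_comp (hg1.deriv_of_isOpen hU le_rfl) hQ hmaps
  have hW : ∀ i j, Torus.IsSmooth (torusVorticityTensor v i j) :=
    fun i j => isSmooth_torusVorticityTensor' hv i j
  have hDW : ∀ i j k, Torus.IsSmooth (Torus.partialDeriv k (torusVorticityTensor v i j)) :=
    fun i j k => (hW i j).partialDeriv k
  have hDQ : ∀ k, Torus.IsSmooth (Torus.partialDeriv k (torusVorticitySqAt v)) :=
    fun k => hQ.partialDeriv k
  -- names
  set G1 : UnitAddTorus d → ℝ := fun y => deriv g (torusVorticitySqAt v y) with hG1def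
  set G2 : UnitAddTorus d → ℝ := fun y => deriv (deriv g) (torusVorticitySqAt v y) with hG2def
  -- `∂ₖ G1 = G2 ∂ₖ|ω|²`
  have hDG1 : ∀ k x, Torus.partialDeriv k G1 x = G2 x * Torus.partialDeriv k (torusVorticitySqAt v) x := by
    intro k x
    have hgd : DifferentiableAt ℝ (deriv g) (torusVorticitySqAt v x) :=
      (hg1.differentiableOn (by simp)).differentiableAt (hU.mem_nhds (hmaps x))
    exact VorticityTensor.partialDeriv_comp_deriv (hQ.isContDiff (by simp)) x hgd k
  -- Step 1: move `G1` inside and integrate by parts in each `(i, j)` term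
  have hibp : ∀ i j, ∫ x, (G1 x * torusVorticityTensor v i j x) *
      Torus.laplacian (torusVorticityTensor v i j) x =
      -∑ k, ∫ x, (G1 x * Torus.partialDeriv k (torusVorticityTensor v i j) x +
          G2 x * Torus.partialDeriv k (torusVorticitySqAt v) x * torusVorticityTensor v i j x) *
        Torus.partialDeriv k (torusVorticityTensor v i j) x := by
    intro i j
    have hprod : Torus.IsSmooth (fun y => G1 y * torusVorticityTensor v i j y) := hG1.mul (hW i j)
    rw [Torus.integral_mul_laplacian_eq_neg_sum hprod (hW i j)]
    congr 1
    refine Finset.sum_congr rfl fun k _ => integral_congr_ae (ae_of_all _ fun x => ?_)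
    simp only
    rw [Torus.partialDeriv_mul (hG1.isContDiff (by simp)) ((hW i j).isContDiff (by simp)), hDG1]
  -- Step 2: both sides equal `-∑ᵢⱼₖ ∫ fᵢⱼₖ`
  set F : d → d → d → UnitAddTorus d → ℝ := fun i j k x =>
    (G1 x * Torus.partialDeriv k (torusVorticityTensor v i j) x +
      G2 x * Torus.partialDeriv k (torusVorticitySqAt v) x * torusVorticityTensor v i j x) *
    Torus.partialDeriv k (torusVorticityTensor v i j) x with hFdef
  have hFs : ∀ i j k, Torus.IsSmooth (F i j k) := fun i j k =>
    ((hG1.mul (hDW i j k)).add ((hG2.mul (hDQ k)).mul (hW i j))).mul (hDW i j k)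
  have hFi : ∀ i j k, Integrable (F i j k) := fun i j k => (hFs i j k).integrable
  -- left-hand side
  have hL : ∫ x, G1 x * ∑ i, ∑ j,
      torusVorticityTensor v i j x * Torus.laplacian (torusVorticityTensor v i j) x =
      -∑ i, ∑ j, ∑ k, ∫ x, F i j k x := by
    have hint : ∀ i j, Integrable (fun x => (G1 x * torusVorticityTensor v i j x) *
        Torus.laplacian (torusVorticityTensor v i j) x) := by
      intro i j
      have h : Torus.IsSmooth (fun x => (G1 x * torusVorticityTensor v i j x) *
          Torus.laplacian (torusVorticityTensor v i j) x) := (hG1.mul (hW i j)).mul (hW i j).laplacian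
      exact h.integrable
    have h1 : ∫ x, G1 x * ∑ i, ∑ j,
        torusVorticityTensor v i j x * Torus.laplacian (torusVorticityTensor v i j) x =
        ∫ x, ∑ i, ∑ j, (G1 x * torusVorticityTensor v i j x) *
          Torus.laplacian (torusVorticityTensor v i j) x := by
      refine integral_congr_ae (ae_of_all _ fun x => ?_)
      simp only
      rw [Finset.mul_sum]
      refine Finset.sum_congr rfl fun i _ => ?_
      rw [Finset.mul_sum]
      refine Finset.sum_congr rfl fun j _ => by ring
    rw [h1, integral_finsetSum _ fun i _ => integrable_finsetSum _ fun j _ => hint i j]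
    simp_rw [integral_finsetSum _ fun j _ => hint _ j, hibp, Finset.sum_neg_distrib]
    rfl
  -- right-hand side, pointwise regrouping
  have hR : ∀ x, G1 x * (∑ k, ∑ i, ∑ j, Torus.partialDeriv k (torusVorticityTensor v i j) x ^ 2) +
      G2 x * ∑ k, Torus.partialDeriv k (torusVorticitySqAt v) x ^ 2 = ∑ i, ∑ j, ∑ k, F i j k x := by
    intro x
    have hsq : ∀ k, Torus.partialDeriv k (torusVorticitySqAt v) x ^ 2 =
        ∑ i, ∑ j, Torus.partialDeriv k (torusVorticitySqAt v) x *
          (torusVorticityTensor v i j x * Torus.partialDeriv k (torusVorticityTensor v i j) x) := by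
      intro k
      rw [sq]
      conv_lhs => arg 2; rw [partialDeriv_torusVorticitySqAt hv k x]
      simp_rw [Finset.mul_sum]
    simp_rw [hsq, Finset.mul_sum, ← Finset.sum_add_distrib]
    rw [Finset.sum_comm]
    refine Finset.sum_congr rfl fun i _ => ?_
    rw [Finset.sum_comm]
    refine Finset.sum_congr rfl fun j _ => Finset.sum_congr rfl fun k _ => ?_
    simp only [hFdef]
    ring
  have hRint : (∫ x, G1 x * ∑ k, ∑ i, ∑ j, Torus.partialDeriv k (torusVorticityTensor v i j) x ^ 2) +
      ∫ x, G2 x * ∑ k, Torus.partialDeriv k (torusVorticitySqAt v) x ^ 2 =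
      ∑ i, ∑ j, ∑ k, ∫ x, F i j k x := by
    have iA : Integrable (fun x => G1 x * ∑ k, ∑ i, ∑ j,
        Torus.partialDeriv k (torusVorticityTensor v i j) x ^ 2) := by
      have h : Torus.IsSmooth (fun x => G1 x * ∑ k, ∑ i, ∑ j,
          Torus.partialDeriv k (torusVorticityTensor v i j) x ^ 2) := by
        have hp : ∀ i j k, Torus.IsSmooth (fun x => Torus.partialDeriv k (torusVorticityTensor v i j) x ^ 2) :=
          fun i j k => (hDW i j k).pow 2
        unfold Torus.IsSmooth at hp hG1 ⊢
        exact hG1.mul (ContDiff.sum fun k _ => ContDiff.sum fun i _ => ContDiff.sum fun j _ => hp i j k)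
      exact h.integrable
    have iB : Integrable (fun x => G2 x * ∑ k, Torus.partialDeriv k (torusVorticitySqAt v) x ^ 2) := by
      have h : Torus.IsSmooth (fun x => G2 x * ∑ k, Torus.partialDeriv k (torusVorticitySqAt v) x ^ 2) := by
        have hp : ∀ k, Torus.IsSmooth (fun x => Torus.partialDeriv k (torusVorticitySqAt v) x ^ 2) :=
          fun k => (hDQ k).pow 2
        unfold Torus.IsSmooth at hp hG2 ⊢
        exact hG2.mul (ContDiff.sum fun k _ => hp k)
      exact h.integrable
    rw [← integral_add iA iB]
    simp_rw [hR]
    rw [integral_finsetSum _ fun i _ => integrable_finsetSum _ fun j _ =>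
      integrable_finsetSum _ fun k _ => hFi i j k]
    simp_rw [integral_finsetSum _ fun j _ => integrable_finsetSum _ fun k _ => hFi _ j k,
      integral_finsetSum _ fun k _ => hFi _ _ k]
  rw [hL]
  linarith [hRint]


end Literature.Analysis.FluidPDE
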